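import Summits.QuantumAdvantage.QuantumAdvantage.Theses.RandomOracleGauge

/-!
# Crux `VarianceAmplification` (stmt-QuantumAdvantage-17874) — line `average-and-clip`

ELEMENTARY amplifier (no gain selection, no dichotomy): AVERAGE `m = ⌈100/ε⌉` independent copies of the
centred polynomial, `σ = (1/m) Σ_{j<m} (p(x⁽ʲ⁾) − E p)` (degree `d`, `|σ| ≤ 1`, `E σ = 0`, `E σ² = Var p/m`,
`E σ⁴ ≤ Var p/m³ + 3 (Var p)²/m²` — fourth moment of an i.i.d. sum — and every influence of `σ` is an influence of
`p` divided by `m²`), then CLIP at five standard deviations: `Y = 1/2 + S_k(σ)/2` with the outer polynomial `S_k` of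
gain `k ≈ 1/(10·sd(σ)) ≤ 2/ε` (bounded by `1`, `2k`-Lipschitz, slope `≥ k/16` on `|u| ≤ 1/(2k) ⊇ [−5 sd, 5 sd]`).
Chebyshev + the fourth-moment bound give `Var Y ≥ (k/32)²·(A·B − C²) ≥ 10⁻⁶` (an ABSOLUTE constant), the degree is
`deg S_k · d = poly(1/ε)·d`, and `Inf_{(j,i)} Y ≤ k² Inf_i p/m² ≤ Inf_i p`. Four stubs, all provable now; the
composition `VarianceAmplification_of` is kernel-checked below (sorries only in the stubs).
-/

set_option linter.dupNamespace false

open Literature.Computability.QuantumComplexity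
open Summit.QuantumAdvantage.QuantumAdvantage.Theses.RandomOracleGauge

namespace Summit.QuantumAdvantage.QuantumAdvantage.Cruxes.VarianceAmplification.AverageAndClip

/-! ### Named statements of the stubs (verbatim; `Registered.stub_*` below are the name-keyed aliases used as the
hypotheses of `VarianceAmplification_of` — the native skeleton audit admits a hypothesis by the last name component of its head) -/

/-- Statement of `stub_outerPoly` (verbatim). -/
abbrev OuterPolyStmt : Prop :=
    ∃ (κ : ℕ) (K : ℝ), 0 < K ∧ ∀ k : ℕ, 1 ≤ k → ∃ S : Polynomial ℝ, (S.natDegree : ℝ) ≤ K * (k : ℝ) ^ κ ∧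
      (∀ u : ℝ, |u| ≤ 1 → |S.eval u| ≤ 1) ∧
      (∀ u v : ℝ, |u| ≤ 1 → |v| ≤ 1 → |S.eval u - S.eval v| ≤ 2 * k * |u - v|) ∧
      (∀ u v : ℝ, -1 ≤ v → v ≤ u → u ≤ 1 → (u - v) / 64 ≤ S.eval u - S.eval v) ∧
      (∀ u v : ℝ, |u| ≤ 1 / (2 * k) → |v| ≤ 1 / (2 * k) → v ≤ u → k * (u - v) / 16 ≤ S.eval u - S.eval v)

/-- Statement of `stub_average` (verbatim). -/
abbrev AverageStmt : Prop :=
    ∀ (N d m : ℕ) (p : MvPolynomial (Fin N) ℝ), 1 ≤ m → p.totalDegree ≤ d →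
      (∀ x, 0 ≤ evalBool p x ∧ evalBool p x ≤ 1) →
      ∃ s : MvPolynomial (Fin (m * N)) ℝ, s.totalDegree ≤ d ∧ (∀ x, |evalBool s x| ≤ 1) ∧
        boolAvg (evalBool s) = 0 ∧
        boolAvg (fun x => evalBool s x ^ 2) = boolVariance p / m ∧
        boolAvg (fun x => evalBool s x ^ 4) ≤ boolVariance p / (m : ℝ) ^ 3 + 3 * boolVariance p ^ 2 / (m : ℝ) ^ 2 ∧
        ∀ j : Fin (m * N), ∃ i : Fin N, influence j s ≤ influence i p / (m : ℝ) ^ 2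

/-- Statement of `stub_clip` (verbatim). -/
abbrev ClipStmt : Prop :=
    ∀ (N' : ℕ) (s : MvPolynomial (Fin N') ℝ) (S : Polynomial ℝ) (k : ℕ) (t : ℝ), 1 ≤ k →
      ((∀ u : ℝ, |u| ≤ 1 → |S.eval u| ≤ 1) ∧
        (∀ u v : ℝ, |u| ≤ 1 → |v| ≤ 1 → |S.eval u - S.eval v| ≤ 2 * k * |u - v|) ∧
        (∀ u v : ℝ, -1 ≤ v → v ≤ u → u ≤ 1 → (u - v) / 64 ≤ S.eval u - S.eval v) ∧
        (∀ u v : ℝ, |u| ≤ 1 / (2 * k) → |v| ≤ 1 / (2 * k) → v ≤ u → k * (u - v) / 16 ≤ S.eval u - S.eval v)) →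
      (∀ x, |evalBool s x| ≤ 1) → boolAvg (evalBool s) = 0 → 0 < t → t ≤ 1 / (2 * k) →
      boolAvg (fun x => evalBool s x ^ 4) ≤ t ^ 2 * boolAvg (fun x => evalBool s x ^ 2) →
      boolAvg (fun x => evalBool s x ^ 2) ≤ t ^ 2 →
      ∃ Y : MvPolynomial (Fin N') ℝ, Y.totalDegree ≤ S.natDegree * s.totalDegree ∧
        (∀ x, 0 ≤ evalBool Y x ∧ evalBool Y x ≤ 1) ∧
        (∀ j, influence j Y ≤ (k : ℝ) ^ 2 * influence j s) ∧
        ((k : ℝ) / 32) ^ 2 *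
            ((boolAvg (fun x => evalBool s x ^ 2) - boolAvg (fun x => evalBool s x ^ 4) / t ^ 2) *
                (1 - boolAvg (fun x => evalBool s x ^ 2) / t ^ 2) -
              (boolAvg (fun x => evalBool s x ^ 4) / t ^ 3) ^ 2) ≤ boolVariance Y

/-- Statement of `stub_params` (verbatim). -/
abbrev ParamsStmt : Prop :=
    ∀ (ε V : ℝ), 0 < ε → ε ≤ V → V ≤ 1 → ∃ (m k : ℕ) (t : ℝ), 1 ≤ m ∧ (m : ℝ) ≤ 200 / ε ∧ 1 ≤ k ∧
      (k : ℝ) ≤ 2 / ε ∧ 0 < t ∧ t ≤ 1 / (2 * k) ∧ V / m ≤ t ^ 2 ∧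
      ∀ E4 : ℝ, 0 ≤ E4 → E4 ≤ V / (m : ℝ) ^ 3 + 3 * V ^ 2 / (m : ℝ) ^ 2 →
        E4 ≤ t ^ 2 * (V / m) ∧
        (1 / 1000000 : ℝ) ≤ ((k : ℝ) / 32) ^ 2 * ((V / m - E4 / t ^ 2) * (1 - (V / m) / t ^ 2) - (E4 / t ^ 3) ^ 2)

/-- STUB (outer clipping polynomials; size M): for every gain `k ≥ 1` an explicit `S ∈ ℝ[u]` of degree `≤ K k^κ`,
bounded by `1` on `[−1,1]`, `2k`-Lipschitz there, increasing with slope `≥ 1/64`, and slope `≥ k/16` on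
`|u| ≤ 1/(2k)` (e.g. `(1−σ₀)·F_ℓ + σ₀·u`, `F_ℓ` the `ℓ`-fold iterate of `u ↦ (3u−u³)/2`, `1.5^ℓ ∈ [k, 1.5k)`).
[folklore: majority-amplification / Chebyshev-type polynomials] -/
theorem stub_outerPoly :
    ∃ (κ : ℕ) (K : ℝ), 0 < K ∧ ∀ k : ℕ, 1 ≤ k → ∃ S : Polynomial ℝ, (S.natDegree : ℝ) ≤ K * (k : ℝ) ^ κ ∧
      (∀ u : ℝ, |u| ≤ 1 → |S.eval u| ≤ 1) ∧
      (∀ u v : ℝ, |u| ≤ 1 → |v| ≤ 1 → |S.eval u - S.eval v| ≤ 2 * k * |u - v|) ∧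
      (∀ u v : ℝ, -1 ≤ v → v ≤ u → u ≤ 1 → (u - v) / 64 ≤ S.eval u - S.eval v) ∧
      (∀ u v : ℝ, |u| ≤ 1 / (2 * k) → |v| ≤ 1 / (2 * k) → v ≤ u → k * (u - v) / 16 ≤ S.eval u - S.eval v) := by
  sorry

/-- STUB (averaging i.i.d. copies on the product cube; size M). `σ = (1/m) Σ_{j<m} (p(x⁽ʲ⁾) − E p)` on
`Fin (m·N)` (blocks through `finProdFinEquiv`): degree `≤ d`, `|σ| ≤ 1`, mean `0`, `E σ² = Var p/m`,
`E σ⁴ = (E D⁴ + 3(m−1) (Var p)²)/m³ ≤ Var p/m³ + 3 (Var p)²/m²` (`D = p − E p`, `E D⁴ ≤ E D²`), and flipping the bit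
`(j,i)` changes `σ` by `(p(x⁽ʲ⁾) − p(x⁽ʲ⁾ ⊕ e_i))/m`, so `Inf_{(j,i)} σ = Inf_i p/m²`. [folklore: moments of i.i.d. sums] -/
theorem stub_average :
    ∀ (N d m : ℕ) (p : MvPolynomial (Fin N) ℝ), 1 ≤ m → p.totalDegree ≤ d →
      (∀ x, 0 ≤ evalBool p x ∧ evalBool p x ≤ 1) →
      ∃ s : MvPolynomial (Fin (m * N)) ℝ, s.totalDegree ≤ d ∧ (∀ x, |evalBool s x| ≤ 1) ∧
        boolAvg (evalBool s) = 0 ∧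
        boolAvg (fun x => evalBool s x ^ 2) = boolVariance p / m ∧
        boolAvg (fun x => evalBool s x ^ 4) ≤ boolVariance p / (m : ℝ) ^ 3 + 3 * boolVariance p ^ 2 / (m : ℝ) ^ 2 ∧
        ∀ j : Fin (m * N), ∃ i : Fin N, influence j s ≤ influence i p / (m : ℝ) ^ 2 := by
  sorry

/-- STUB (clipping; size M). For `|σ| ≤ 1` with mean `0` and an admissible outer polynomial `S` of gain `k`, the
composite `Y = 1/2 + S(σ)/2` is a `[0,1]`-bounded polynomial of degree `≤ deg S · deg σ` with `Inf_j Y ≤ k² Inf_j σ`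
(Lipschitz) and — from `|Y − Y'| ≥ (k/32)|σ − σ'|` on the zone `|σ|,|σ'| ≤ t ≤ 1/(2k)`, Chebyshev
`Pr[|σ| > t] ≤ Eσ²/t²`, `E[σ²; |σ| > t] ≤ Eσ⁴/t²` and `|E[σ; |σ| > t]| ≤ Eσ⁴/t³` —
`Var Y ≥ (k/32)² (A·B − C²)`, `A = Eσ² − Eσ⁴/t²`, `B = 1 − Eσ²/t²`, `C = Eσ⁴/t³` (given `A, B ≥ 0`).
[folklore: truncated second moment] -/
theorem stub_clip :
    ∀ (N' : ℕ) (s : MvPolynomial (Fin N') ℝ) (S : Polynomial ℝ) (k : ℕ) (t : ℝ), 1 ≤ k →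
      ((∀ u : ℝ, |u| ≤ 1 → |S.eval u| ≤ 1) ∧
        (∀ u v : ℝ, |u| ≤ 1 → |v| ≤ 1 → |S.eval u - S.eval v| ≤ 2 * k * |u - v|) ∧
        (∀ u v : ℝ, -1 ≤ v → v ≤ u → u ≤ 1 → (u - v) / 64 ≤ S.eval u - S.eval v) ∧
        (∀ u v : ℝ, |u| ≤ 1 / (2 * k) → |v| ≤ 1 / (2 * k) → v ≤ u → k * (u - v) / 16 ≤ S.eval u - S.eval v)) →
      (∀ x, |evalBool s x| ≤ 1) → boolAvg (evalBool s) = 0 → 0 < t → t ≤ 1 / (2 * k) →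
      boolAvg (fun x => evalBool s x ^ 4) ≤ t ^ 2 * boolAvg (fun x => evalBool s x ^ 2) →
      boolAvg (fun x => evalBool s x ^ 2) ≤ t ^ 2 →
      ∃ Y : MvPolynomial (Fin N') ℝ, Y.totalDegree ≤ S.natDegree * s.totalDegree ∧
        (∀ x, 0 ≤ evalBool Y x ∧ evalBool Y x ≤ 1) ∧
        (∀ j, influence j Y ≤ (k : ℝ) ^ 2 * influence j s) ∧
        ((k : ℝ) / 32) ^ 2 *
            ((boolAvg (fun x => evalBool s x ^ 2) - boolAvg (fun x => evalBool s x ^ 4) / t ^ 2) *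
                (1 - boolAvg (fun x => evalBool s x ^ 2) / t ^ 2) -
              (boolAvg (fun x => evalBool s x ^ 4) / t ^ 3) ^ 2) ≤ boolVariance Y := by
  sorry

/-- STUB (parameter selection; size S/M, pure real arithmetic). With `m = ⌈100/ε⌉`, `t² = 25V/m`
(five standard deviations of `σ`) and `k = ⌊1/(2t)⌋`: `m ≤ 200/ε`, `1 ≤ k ≤ 2/ε`, `t ≤ 1/(2k)`, `V/m ≤ t²`,
and for every admissible fourth moment `E4 ≤ V/m³ + 3V²/m² (≤ 4V²/m²)`: `E4 ≤ t²·(V/m)` and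
`(k/32)²((V/m − E4/t²)(1 − (V/m)/t²) − (E4/t³)²) ≥ (m/(409600 V))·0.805·V/m ≥ 10⁻⁶`. [folklore] -/
theorem stub_params :
    ∀ (ε V : ℝ), 0 < ε → ε ≤ V → V ≤ 1 → ∃ (m k : ℕ) (t : ℝ), 1 ≤ m ∧ (m : ℝ) ≤ 200 / ε ∧ 1 ≤ k ∧
      (k : ℝ) ≤ 2 / ε ∧ 0 < t ∧ t ≤ 1 / (2 * k) ∧ V / m ≤ t ^ 2 ∧
      ∀ E4 : ℝ, 0 ≤ E4 → E4 ≤ V / (m : ℝ) ^ 3 + 3 * V ^ 2 / (m : ℝ) ^ 2 →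
        E4 ≤ t ^ 2 * (V / m) ∧
        (1 / 1000000 : ℝ) ≤ ((k : ℝ) / 32) ^ 2 * ((V / m - E4 / t ^ 2) * (1 - (V / m) / t ^ 2) - (E4 / t ^ 3) ^ 2) := by
  sorry

namespace Registered

/-- Alias of `stub_outerPoly`'s statement keyed by the registered stub name. -/
abbrev stub_outerPoly : Prop := OuterPolyStmt
/-- Alias of `stub_average`'s statement keyed by the registered stub name. -/
abbrev stub_average : Prop := AverageStmt
/-- Alias of `stub_clip`'s statement keyed by the registered stub name. -/
abbrev stub_clip : Prop := ClipStmt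
/-- Alias of `stub_params`'s statement keyed by the registered stub name. -/
abbrev stub_params : Prop := ParamsStmt

end Registered

/-! ### bookkeeping -/

theorem boolAvg_le_one'' {N : ℕ} {f : (Fin N → Bool) → ℝ} (hf : ∀ x, f x ≤ 1) : boolAvg f ≤ 1 := by
  unfold boolAvg
  rw [div_le_one (by positivity)]
  calc ∑ x, f x ≤ ∑ _x : Fin N → Bool, (1 : ℝ) := Finset.sum_le_sum fun x _ => hf x
    _ = 2 ^ N := by simp

theorem boolVariance_le_one'' {N : ℕ} {p : MvPolynomial (Fin N) ℝ}
    (hb : ∀ x, 0 ≤ evalBool p x ∧ evalBool p x ≤ 1) : boolVariance p ≤ 1 := by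
  have hμ0 : 0 ≤ boolAvg (evalBool p) := boolAvg_nonneg fun x => (hb x).1
  have hμ1 : boolAvg (evalBool p) ≤ 1 := boolAvg_le_one'' fun x => (hb x).2
  unfold boolVariance
  refine boolAvg_le_one'' fun x => ?_
  have h0 := (hb x).1
  have h1 := (hb x).2
  nlinarith

/-- COMPOSITION (kernel-checked): the four stubs give the crux `VarianceAmplification` by name, with
`v = 10⁻⁶`, `κ_tot = κ + 2`, `K_tot = K·2^κ + 5`. -/
theorem VarianceAmplification_of (hPoly : Registered.stub_outerPoly) (hAvg : Registered.stub_average) (hClip : Registered.stub_clip) (hPar : Registered.stub_params) :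
    VarianceAmplification := by
  obtain ⟨κ₁, K₁, hK₁, hP⟩ := hPoly
  refine ⟨1 / 1000000, K₁ * 2 ^ κ₁ + 5, κ₁ + 2, by norm_num, by positivity, ?_⟩
  intro N d p ε hd hdeg hb hε hεv
  -- the variance level `V` of `p`
  set V : ℝ := boolVariance p with hVdef
  have hV1 : V ≤ 1 := boolVariance_le_one'' hb
  have hε1 : ε ≤ 1 := hεv.trans hV1
  have hd1 : (1 : ℝ) ≤ d := by exact_mod_cast hd
  -- parameters, averaged polynomial, outer polynomial, clipped polynomial
  obtain ⟨m, k, t, hm1, hmle, hk1, hkle, ht, htk, hVt, hE⟩ := hPar ε V hε hεv hV1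
  have hm1' : (1 : ℝ) ≤ m := by exact_mod_cast hm1
  have hk1' : (1 : ℝ) ≤ k := by exact_mod_cast hk1
  obtain ⟨s, hsdeg, hsb, hsmean, hs2, hs4, hsinf⟩ := hAvg N d m p hm1 hdeg hb
  obtain ⟨S, hSdeg, hSP⟩ := hP k hk1
  have hE4 := hE (boolAvg (fun x => evalBool s x ^ 4)) (boolAvg_nonneg fun _ => by positivity) hs4
  have hA : boolAvg (fun x => evalBool s x ^ 4) ≤ t ^ 2 * boolAvg (fun x => evalBool s x ^ 2) := by
    rw [hs2]; exact hE4.1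
  have hB : boolAvg (fun x => evalBool s x ^ 2) ≤ t ^ 2 := by rw [hs2]; exact hVt
  obtain ⟨Y, hYdeg, hYb, hYinf, hYvar⟩ := hClip (m * N) s S k t hk1 hSP hsb hsmean ht htk hA hB
  -- outputs
  refine ⟨m * N, S.natDegree * d + 1, Y, Nat.le_add_left 1 _, ?_, ?_, hYb, ?_, ?_⟩
  · -- degree bound: S.natDegree * d + 1 ≤ K₁ k^κ₁ d + 1 ≤ (K₁ 2^κ₁ + 5) d / ε^(κ₁+2)
    have h1 : ((S.natDegree * d + 1 : ℕ) : ℝ) = S.natDegree * d + 1 := by push_cast; ring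
    rw [h1]
    have hkpow : (k : ℝ) ^ κ₁ ≤ (2 / ε) ^ κ₁ := pow_le_pow_left₀ (by positivity) hkle κ₁
    have h2 : (S.natDegree : ℝ) * d ≤ K₁ * (2 / ε) ^ κ₁ * d := by
      have := mul_le_mul_of_nonneg_right hSdeg (show (0 : ℝ) ≤ d by positivity)
      refine this.trans ?_
      exact mul_le_mul_of_nonneg_right (mul_le_mul_of_nonneg_left hkpow hK₁.le) (by positivity)
    have hεp : 0 < ε ^ (κ₁ + 2) := by positivity
    have hεle : ε ^ (κ₁ + 2) ≤ ε ^ κ₁ := pow_le_pow_of_le_one hε.le hε1 (by omega)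
    have hε1' : ε ^ (κ₁ + 2) ≤ 1 := pow_le_one₀ hε.le hε1
    rw [le_div_iff₀ hεp]
    have h3 : (2 / ε) ^ κ₁ * ε ^ (κ₁ + 2) ≤ 2 ^ κ₁ := by
      rw [div_pow]
      calc 2 ^ κ₁ / ε ^ κ₁ * ε ^ (κ₁ + 2) ≤ 2 ^ κ₁ / ε ^ κ₁ * ε ^ κ₁ :=
            mul_le_mul_of_nonneg_left hεle (by positivity)
        _ = 2 ^ κ₁ := by field_simp
    calc ((S.natDegree : ℝ) * d + 1) * ε ^ (κ₁ + 2)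
        ≤ (K₁ * (2 / ε) ^ κ₁ * d + 1) * ε ^ (κ₁ + 2) := mul_le_mul_of_nonneg_right (by linarith) hεp.le
      _ = K₁ * d * ((2 / ε) ^ κ₁ * ε ^ (κ₁ + 2)) + ε ^ (κ₁ + 2) := by ring
      _ ≤ K₁ * d * 2 ^ κ₁ + 1 := add_le_add (mul_le_mul_of_nonneg_left h3 (by positivity)) hε1'
      _ ≤ K₁ * d * 2 ^ κ₁ + 5 * d := by linarith
      _ = (K₁ * 2 ^ κ₁ + 5) * d := by ring
  · -- total degree of Y
    calc Y.totalDegree ≤ S.natDegree * s.totalDegree := hYdeg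
      _ ≤ S.natDegree * d := Nat.mul_le_mul_left _ hsdeg
      _ ≤ S.natDegree * d + 1 := Nat.le_succ _
  · -- the absolute variance level
    rw [hs2] at hYvar
    exact hE4.2.trans hYvar
  · -- influences: Inf_j Y ≤ k² Inf_j s ≤ k² Inf_i p / m² ≤ (2/ε)² Inf_i p ≤ K_tot / ε^(κ₁+2) Inf_i p
    intro j
    obtain ⟨i, hi⟩ := hsinf j
    refine ⟨i, (hYinf j).trans ?_⟩
    have hIp : 0 ≤ influence i p := influence_nonneg i p
    have hm2 : (1 : ℝ) ≤ (m : ℝ) ^ 2 := one_le_pow₀ hm1'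
    have step1 : (k : ℝ) ^ 2 * influence j s ≤ (k : ℝ) ^ 2 * influence i p := by
      apply mul_le_mul_of_nonneg_left _ (by positivity)
      exact hi.trans (div_le_self hIp hm2)
    have hk2 : (k : ℝ) ^ 2 ≤ (2 / ε) ^ 2 := pow_le_pow_left₀ (by positivity) hkle 2
    have hεpow : ε ^ (κ₁ + 2) ≤ ε ^ 2 := pow_le_pow_of_le_one hε.le hε1 (by omega)
    calc (k : ℝ) ^ 2 * influence j s ≤ (k : ℝ) ^ 2 * influence i p := step1
      _ ≤ (2 / ε) ^ 2 * influence i p := mul_le_mul_of_nonneg_right hk2 hIp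
      _ = 4 / ε ^ 2 * influence i p := by rw [div_pow]; norm_num
      _ ≤ 4 / ε ^ (κ₁ + 2) * influence i p := by
          apply mul_le_mul_of_nonneg_right _ hIp
          exact div_le_div_of_nonneg_left (by norm_num) (by positivity) hεpow
      _ ≤ (K₁ * 2 ^ κ₁ + 5) / ε ^ (κ₁ + 2) * influence i p := by
          apply mul_le_mul_of_nonneg_right _ hIp
          apply div_le_div_of_nonneg_right _ (by positivity)
          have : (0 : ℝ) ≤ K₁ * 2 ^ κ₁ := by positivity
          linarith

/-- Wiring check: the stub theorems feed `VarianceAmplification_of` as stated (the verbatim restatements are definitionally the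
registered aliases). An unnamed `example`, so that `VarianceAmplification_of` stays the only declaration concluding the crux by name. -/
example : VarianceAmplification :=
  VarianceAmplification_of stub_outerPoly stub_average stub_clip stub_params

end Summit.QuantumAdvantage.QuantumAdvantage.Cruxes.VarianceAmplification.AverageAndClip
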